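import Summits.CriticalPhenomena.PercolationContinuityZ3.Theorems.PercNearOneGluingNoHeavyLowerTailSunflowerGradedSafeBlocks
import HarnessLib

/-!
# `NoHeavyLowerTail` (crux stmt-CriticalPhenomena-4575), abstract sunflower cubic: SAFE CORES — the calculus, part 2
# (GRADED safety, the disjunction rules)

Support file (seat `prim-ineq-prove-1` gen 34; `--supports stmt-CriticalPhenomena-4575`).  No `sorry`, no named facts.  Memo:
run/shared/lean/prim/prim-ineq-prove-1/FINDING-PRINCIPALCORE-prove1-g34.md §9.

SETTING.  `μ = prodBernoulli p` on `Set ι` (`ι` finite), a block `a : Finset ι` of coordinates.  For `T ⊆ a` (the MISSING part of the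
block) `TwoGenCore.cyl a T` is the cylinder `{ω | ω ∩ a = a ∖ T}` with `μ(cyl a T) = wmiss p a T`, and
`sect a T V = {ω | (ω ∖ a) ∪ (a ∖ T) ∈ V}` is the SECTION of `V` along it (an event determined by `aᶜ`).  The conditioning formula
`real_eq_BEx : μ(V) = Σ_{T ⊆ a} wmiss p a T · μ(sect a T V) = BEx p a (μ ∘ sect · V)` is independence of the block and its complement
(technical layer `…SunflowerGradedSafeBlocks`).
GRADED SAFETY of an event `A` determined by the block `a` (`GSafe p a A`): for all `n`, all floors `c ∈ (0,1]` and all families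
`G i : (T ⊆ a) → [c,1]` antitone in `T`, equal to `1` when the block point `a ∖ T` lies in `A` and with `∏_i G i T ≤ c^(n−1)` when
it does not: `∏_i BEx p a (G i) ≤ (μ A + (1 − μ A)c)^(n−1)`.  (With two-valued `G` this is safety of `A ∨ (fresh coordinate of
probability c)`; it is the abstract form of the K-decreasing-functions lemma.)
* `gsafe_principal` — principal filters `{a ⊆ ω}` are gradedly safe: this IS `KDecreasing.prod_Ex_le_of_antitone'` (T3).
* **`safe_union_of_gsafe`** (memo §9 (ii), the abstract box-lemma step) — `A₁` determined by `a` and GRADEDLY safe, `A₂` determined by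
  `aᶜ`, safe and of positive probability ⟹ `A₁ ∪ A₂` is safe.  Proof: enlarge `V i` to `V i ∪ (A₁ ∪ A₂)`, condition on the block:
  `G i T := μ(sect a T (V i))` is `1` at good `T`, `≥ μ A₂ =: c` everywhere, and at bad `T` the sections meet pairwise inside `A₂`,
  so `∏ G i T ≤ c^(n−1)` by safety of `A₂`; graded safety of `A₁` finishes since `μ(A₁ ∪ A₂) = μA₁ + (1 − μA₁)c`.
* **`gsafe_union`** (memo §9 (iii)) — graded safety is closed under disjunction on disjoint blocks (condition on the first block;
  Fubini `BEx_union` for `wmiss`).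
* **`safe_of_gsafe`** — graded safety implies safety (two-valued functions `c + (1 − c)·1[block point ∈ capIn a (V i ∪ A)]`, floor `c → 0`).
CONSEQUENCE (with part 1's `safe_inter`, `safe_principal`): every core obtained from read-once DNFs on disjoint blocks (gradedly safe by
`gsafe_principal` + `gsafe_union`) by disjoint conjunctions (`safe_inter`) and by disjunctions with such DNFs (`safe_union_of_gsafe`) is
SAFE — Lemma A, (C1-law), the `H`/`G`/`T` rows unconditionally (part 1, `…_of_safe`).  This class contains every Δ-system core
(kernel ∧ DNF), `(x₁ ∨ x₂) ∧ (x₃ ∨ x₄)`, `x₁ ∧ (x₂ ∨ x₃ ∧ (x₄ ∨ x₅))`, and all read-once cores on ≤ 5 coordinates; the examples are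
spelled out in `…SunflowerSafeExamples`.  OPEN: graded safety of a conjunction (would give every read-once core; the naive
two-floor relaxation is false, memo §4 CLAIM*), and safety beyond read-once cores (`{12,23,14}` is safe numerically).
-/

noncomputable section

namespace Summit.CriticalPhenomena.PercolationContinuityZ3.Theorems.SunflowerPartition

namespace SafeCalc

open MeasureTheory Finset Filter Topology
open Literature.Probability.LatticeModels Literature.Probability.Percolation
open TwoGenCore (wmiss cyl)

variable {ι : Type*} [DecidableEq ι]

variable (p : ι → unitInterval)

/-! ## Graded safety -/

/-- **Graded safety** of an event `A` determined by the block `a` (memo §9): for every number of players `n`, floor `c ∈ (0,1]`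
and functions `G i` of the missing part `T ⊆ a` which are antitone, `[c,1]`-valued, equal to `1` when the block point `a ∖ T`
lies in `A`, and have `∏_i G i T ≤ c^(n−1)` when it does not: `∏_i BEx p a (G i) ≤ (μA + (1 − μA)c)^(n−1)`. [this work] -/
def GSafe (p : ι → unitInterval) (a : Finset ι) (A : Set (Set ι)) : Prop :=
  ∀ (n : ℕ) (c : ℝ), 0 < c → c ≤ 1 → ∀ (G : Fin n → Finset ι → ℝ),
    (∀ i, ∀ T T' : Finset ι, T ⊆ T' → T' ⊆ a → G i T' ≤ G i T) →
    (∀ i, ∀ T : Finset ι, T ⊆ a → G i T ≤ 1) →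
    (∀ i, ∀ T : Finset ι, T ⊆ a → c ≤ G i T) →
    (∀ i, ∀ T : Finset ι, T ⊆ a → ((a \ T : Finset ι) : Set ι) ∈ A → G i T = 1) →
    (∀ T : Finset ι, T ⊆ a → ((a \ T : Finset ι) : Set ι) ∉ A → ∏ i, G i T ≤ c ^ (n - 1)) →
      ∏ i, BEx p a (G i) ≤ ((prodBernoulli p).real A + (1 - (prodBernoulli p).real A) * c) ^ (n - 1)

/-- **Principal filters are gradedly safe** — this is the K-decreasing-functions lemma `KDecreasing.prod_Ex_le_of_antitone'`
(T3), transported from the subtype cube `Finset ↥a` to the block `a`. [this work] -/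
theorem gsafe_principal [Fintype ι] (a : Finset ι) : GSafe p a {ω | (↑a : Set ι) ⊆ ω} := by
  classical
  intro n c hc hc1 G hanti hle1 hge _ hbad
  have hq : ∀ x : ↥a, 0 ≤ ((p x : unitInterval) : ℝ) ∧ ((p x : unitInterval) : ℝ) ≤ 1 := fun x => ⟨(p x).2.1, (p x).2.2⟩
  let emb := Function.Embedding.subtype (· ∈ a)
  let G' : Fin n → Finset ↥a → ℝ := fun i S => G i (S.map emb)
  have hmapsub : ∀ S : Finset ↥a, S.map emb ⊆ a := by
    intro S e he
    rw [Finset.mem_map] at he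
    obtain ⟨x, _, rfl⟩ := he
    exact x.2
  have key := KDecreasing.prod_Ex_le_of_antitone' (g := ↥a) (Finset.univ : Finset (Fin n)) hq hc hc1 G'
    (fun i _ S S' hSS' => hanti i _ _ (Finset.map_subset_map.2 hSS') (hmapsub S'))
    (fun i _ S => hge i _ (hmapsub S)) (fun i _ S => hle1 i _ (hmapsub S)) ?_
  · have hP1 : ∏ x : ↥a, ((p x : unitInterval) : ℝ) = ∏ e ∈ a, (p e : ℝ) :=
      Finset.prod_coe_sort a (fun e => ((p e : unitInterval) : ℝ))
    rw [hP1, Finset.card_univ, Fintype.card_fin] at key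
    have hEx : ∀ i, BEx p a (G i) = KDecreasing.Ex (g := ↥a) (fun x => (p x : ℝ)) (G' i) := by
      intro i
      unfold BEx KDecreasing.Ex
      symm
      refine Finset.sum_bij (fun S _ => S.map emb) (fun S _ => Finset.mem_powerset.2 (hmapsub S))
        (fun S _ S' _ h => Finset.map_injective _ h) (fun T hT => ?_) (fun S _ => ?_)
      · refine ⟨T.subtype (· ∈ a), Finset.mem_univ _, ?_⟩
        rw [Finset.mem_powerset] at hT
        exact Finset.subtype_map_of_mem fun x hx => hT hx
      · congr 1
        unfold KDecreasing.wt TwoGenCore.wmiss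
        set T := S.map emb with hT
        have h1 : (∏ x : ↥a, if x ∈ S then 1 - ((p x : unitInterval) : ℝ) else ((p x : unitInterval) : ℝ)) =
            ∏ e ∈ a, (if e ∈ T then 1 - (p e : ℝ) else (p e : ℝ)) := by
          rw [← Finset.prod_coe_sort a (fun e => if e ∈ T then 1 - (p e : ℝ) else (p e : ℝ))]
          refine Finset.prod_congr rfl fun x _ => ?_
          have hx : ((x : ι) ∈ T) ↔ x ∈ S := by rw [hT]; exact Finset.mem_map' _
          by_cases hxS : x ∈ S
          · rw [if_pos hxS, if_pos (hx.2 hxS)]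
          · rw [if_neg hxS, if_neg (fun h => hxS (hx.1 h))]
        rw [h1, Finset.prod_ite, Finset.filter_mem_eq_inter, Finset.inter_eq_right.2 (hmapsub S), Finset.filter_not,
          Finset.filter_mem_eq_inter, Finset.inter_eq_right.2 (hmapsub S)]
    rw [prodBernoulli_real_subset]
    calc ∏ i, BEx p a (G i) = ∏ i, KDecreasing.Ex (g := ↥a) (fun x => (p x : ℝ)) (G' i) :=
          Finset.prod_congr rfl fun i _ => hEx i
      _ ≤ ((∏ e ∈ a, (p e : ℝ)) + (1 - ∏ e ∈ a, (p e : ℝ)) * c) ^ (n - 1) := key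
  · intro S hS
    rw [Finset.card_univ, Fintype.card_fin]
    refine hbad _ (hmapsub S) fun hsub => ?_
    obtain ⟨x, hx⟩ := hS
    have hxT : (x : ι) ∈ S.map emb := Finset.mem_map_of_mem emb hx
    have hxa : (x : ι) ∈ ((a \ S.map emb : Finset ι) : Set ι) := hsub (Finset.mem_coe.2 x.2)
    exact (Finset.mem_sdiff.1 (Finset.mem_coe.1 hxa)).2 hxT

/-! ## The disjunction rules -/

/-- **A gradedly safe event OR a safe event on the complementary block is safe** (memo §9 (ii) — the abstract form of the box
lemma's induction step). [this work] -/
theorem safe_union_of_gsafe [Fintype ι] (a : Finset ι) {A₁ A₂ : Set (Set ι)}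
    (hd₁ : DeterminedBy A₁ (↑a : Set ι)) (hd₂ : DeterminedBy A₂ (↑a : Set ι)ᶜ)
    (hu₁ : IsUpperSet A₁) (hu₂ : IsUpperSet A₂) (hpos : 0 < (prodBernoulli p).real A₂)
    (h₁ : GSafe p a A₁) (h₂ : Safe p A₂) : Safe p (A₁ ∪ A₂) := by
  classical
  intro n V hV hcap
  have hc1 : (prodBernoulli p).real A₂ ≤ 1 := measureReal_le_one
  -- enlarge the family by the core
  let V' : Fin n → Set (Set ι) := fun i => V i ∪ (A₁ ∪ A₂)
  have hV' : ∀ i, IsUpperSet (V' i) := fun i => (hV i).union (hu₁.union hu₂)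
  have hA₁V' : ∀ i, A₁ ⊆ V' i := fun i => Set.subset_union_left.trans Set.subset_union_right
  have hA₂V' : ∀ i, A₂ ⊆ V' i := fun i => Set.subset_union_right.trans Set.subset_union_right
  have hcap' : ∀ i j, i ≠ j → V' i ∩ V' j ⊆ A₁ ∪ A₂ := by
    rintro i j hij ω ⟨hi | hi, hj | hj⟩
    · exact hcap i j hij ⟨hi, hj⟩
    · exact hj
    · exact hi
    · exact hi
  let f : Fin n → Finset ι → ℝ := fun i T => (prodBernoulli p).real (sect a T (V' i))
  have hanti : ∀ i, ∀ T T' : Finset ι, T ⊆ T' → T' ⊆ a → f i T' ≤ f i T :=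
    fun i T T' hTT' _ => measureReal_mono (sect_anti a hTT' (hV' i))
  have hle1 : ∀ i, ∀ T : Finset ι, T ⊆ a → f i T ≤ 1 := fun i T _ => measureReal_le_one
  have hgood : ∀ i, ∀ T : Finset ι, T ⊆ a → ((a \ T : Finset ι) : Set ι) ∈ A₁ → f i T = 1 := by
    intro i T _ hT
    have hs : sect a T (V' i) = Set.univ :=
      Set.eq_univ_of_univ_subset ((sect_eq_univ_of_mem hd₁ hT).symm.subset.trans (sect_mono a T (hA₁V' i)))
    change (prodBernoulli p).real (sect a T (V' i)) = 1
    rw [hs, probReal_univ]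
  have hge : ∀ i, ∀ T : Finset ι, T ⊆ a → (prodBernoulli p).real A₂ ≤ f i T := fun i T _ =>
    measureReal_mono ((sect_eq_self_of_determinedBy_compl a T hd₂).symm.subset.trans (sect_mono a T (hA₂V' i)))
  have hbad : ∀ T : Finset ι, T ⊆ a → ((a \ T : Finset ι) : Set ι) ∉ A₁ →
      ∏ i, f i T ≤ ((prodBernoulli p).real A₂) ^ (n - 1) := by
    intro T _ hT
    have hS : ∀ i j, i ≠ j → sect a T (V' i) ∩ sect a T (V' j) ⊆ A₂ := by
      intro i j hij
      rw [← sect_inter]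
      refine (sect_mono a T (hcap' i j hij)).trans ?_
      rw [sect_union, sect_eq_empty_of_not_mem hd₁ hT, Set.empty_union, sect_eq_self_of_determinedBy_compl a T hd₂]
    exact h₂ n (fun i => sect a T (V' i)) (fun i => isUpperSet_sect a T (hV' i)) hS
  have key := h₁ n ((prodBernoulli p).real A₂) hpos hc1 f hanti hle1 hge hgood hbad
  have hunion : (prodBernoulli p).real (A₁ ∪ A₂) =
      (prodBernoulli p).real A₁ + (1 - (prodBernoulli p).real A₁) * (prodBernoulli p).real A₂ := by
    have h := measureReal_union_add_inter (μ := prodBernoulli p) (s := A₁) (MeasurableSet.of_discrete : MeasurableSet A₂)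
    rw [prodBernoulli_real_inter_of_determinedBy p a hd₁ hd₂ MeasurableSet.of_discrete MeasurableSet.of_discrete] at h
    linear_combination h
  rw [hunion]
  calc ∏ i, (prodBernoulli p).real (V i) ≤ ∏ i, (prodBernoulli p).real (V' i) :=
        Finset.prod_le_prod (fun i _ => measureReal_nonneg) fun i _ => measureReal_mono Set.subset_union_left
    _ = ∏ i, BEx p a (f i) := Finset.prod_congr rfl fun i _ => real_eq_BEx p a (V' i)
    _ ≤ _ := key

/-- The probability of an event determined by a block, as a block expectation of its indicator. [this work] -/
theorem BEx_indicator_eq_real [Fintype ι] {b : Finset ι} {A : Set (Set ι)} [DecidablePred (· ∈ A)]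
    (hd : DeterminedBy A (↑b : Set ι)) :
    BEx p b (fun T => if ((b \ T : Finset ι) : Set ι) ∈ A then (1 : ℝ) else 0) = (prodBernoulli p).real A := by
  rw [real_eq_BEx p b A]
  refine Finset.sum_congr rfl fun T _ => ?_
  congr 1
  dsimp only
  split_ifs with h
  · rw [sect_eq_univ_of_mem hd h, probReal_univ]
  · rw [sect_eq_empty_of_not_mem hd h, measureReal_empty]

/-- **Graded safety is closed under disjunction on disjoint blocks** (memo §9 (iii)). [this work] -/
theorem gsafe_union [Fintype ι] {a b : Finset ι} (hab : Disjoint a b) {A₁ A₂ : Set (Set ι)}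
    (hd₁ : DeterminedBy A₁ (↑a : Set ι)) (hd₂ : DeterminedBy A₂ (↑b : Set ι))
    (h₁ : GSafe p a A₁) (h₂ : GSafe p b A₂) : GSafe p (a ∪ b) (A₁ ∪ A₂) := by
  classical
  intro n c hc hc1 G hanti hle1 hge hgood hbad
  have hP₂0 : 0 ≤ (prodBernoulli p).real A₂ := measureReal_nonneg
  have hP₂1 : (prodBernoulli p).real A₂ ≤ 1 := measureReal_le_one
  -- the intermediate floor `c' = P₂ + (1 − P₂) c`
  obtain ⟨c', hc'⟩ : ∃ c', c' = (prodBernoulli p).real A₂ + (1 - (prodBernoulli p).real A₂) * c := ⟨_, rfl⟩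
  have hc'pos : 0 < c' := by rw [hc']; nlinarith
  have hc'1 : c' ≤ 1 := by rw [hc']; nlinarith
  -- block points
  have hpt₁ : ∀ T₁ T₂ : Finset ι, T₁ ⊆ a → T₂ ⊆ b →
      ((((a ∪ b) \ (T₁ ∪ T₂) : Finset ι) : Set ι) ∈ A₁ ↔ ((a \ T₁ : Finset ι) : Set ι) ∈ A₁) := by
    intro T₁ T₂ _ h2
    refine (determinedBy_iff A₁ _).1 hd₁ _ _ ?_
    ext e
    simp only [Set.mem_inter_iff, Finset.mem_coe, Finset.mem_sdiff, Finset.mem_union]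
    constructor
    · rintro ⟨⟨_, hn⟩, hea⟩
      exact ⟨⟨hea, fun h => hn (Or.inl h)⟩, hea⟩
    · rintro ⟨⟨hea, hn⟩, _⟩
      exact ⟨⟨Or.inl hea, fun h => h.elim hn fun h' => Finset.disjoint_left.1 hab hea (h2 h')⟩, hea⟩
  have hpt₂ : ∀ T₁ T₂ : Finset ι, T₁ ⊆ a → T₂ ⊆ b →
      ((((a ∪ b) \ (T₁ ∪ T₂) : Finset ι) : Set ι) ∈ A₂ ↔ ((b \ T₂ : Finset ι) : Set ι) ∈ A₂) := by
    intro T₁ T₂ h1 _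
    refine (determinedBy_iff A₂ _).1 hd₂ _ _ ?_
    ext e
    simp only [Set.mem_inter_iff, Finset.mem_coe, Finset.mem_sdiff, Finset.mem_union]
    constructor
    · rintro ⟨⟨_, hn⟩, heb⟩
      exact ⟨⟨heb, fun h => hn (Or.inr h)⟩, heb⟩
    · rintro ⟨⟨heb, hn⟩, _⟩
      exact ⟨⟨Or.inr heb, fun h => h.elim (fun h' => Finset.disjoint_left.1 hab (h1 h') heb) hn⟩, heb⟩
  -- the conditioned functions on the first block
  let g : Fin n → Finset ι → ℝ := fun i T₁ => BEx p b (fun T₂ => G i (T₁ ∪ T₂))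
  have g_anti : ∀ i, ∀ T T' : Finset ι, T ⊆ T' → T' ⊆ a → g i T' ≤ g i T := by
    intro i T T' hTT' hT'a
    refine BEx_mono p b fun T₂ hT₂ => ?_
    exact hanti i _ _ (Finset.union_subset_union hTT' subset_rfl) (Finset.union_subset_union hT'a hT₂)
  have g_le : ∀ i, ∀ T : Finset ι, T ⊆ a → g i T ≤ 1 := by
    intro i T hT
    calc g i T ≤ BEx p b (fun _ => 1) := BEx_mono p b fun T₂ hT₂ => hle1 i _ (Finset.union_subset_union hT hT₂)
      _ = 1 := BEx_const p b 1
  have g_good : ∀ i, ∀ T : Finset ι, T ⊆ a → ((a \ T : Finset ι) : Set ι) ∈ A₁ → g i T = 1 := by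
    intro i T hT hgoodT
    calc g i T = BEx p b (fun _ => 1) := by
          refine Finset.sum_congr rfl fun T₂ hT₂ => ?_
          have hT₂' := Finset.mem_powerset.1 hT₂
          change wmiss p b T₂ * G i (T ∪ T₂) = wmiss p b T₂ * 1
          rw [hgood i _ (Finset.union_subset_union hT hT₂') (Or.inl ((hpt₁ T T₂ hT hT₂').2 hgoodT))]
      _ = 1 := BEx_const p b 1
  have g_ge : ∀ i, ∀ T : Finset ι, T ⊆ a → c' ≤ g i T := by
    intro i T hT
    have hval : BEx p b (fun T₂ => if ((b \ T₂ : Finset ι) : Set ι) ∈ A₂ then (1 : ℝ) else c) = c' := by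
      have hfun : (fun T₂ : Finset ι => if ((b \ T₂ : Finset ι) : Set ι) ∈ A₂ then (1 : ℝ) else c) =
          fun T₂ => c + (1 - c) * (if ((b \ T₂ : Finset ι) : Set ι) ∈ A₂ then (1 : ℝ) else 0) := by
        funext T₂
        split_ifs <;> ring
      rw [hfun, BEx_affine, BEx_indicator_eq_real p hd₂, hc']
      ring
    rw [← hval]
    refine BEx_mono p b fun T₂ hT₂ => ?_
    split_ifs with h
    · exact (hgood i _ (Finset.union_subset_union hT hT₂) (Or.inr ((hpt₂ T T₂ hT hT₂).2 h))).symm.le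
    · exact hge i _ (Finset.union_subset_union hT hT₂)
  have g_bad : ∀ T : Finset ι, T ⊆ a → ((a \ T : Finset ι) : Set ι) ∉ A₁ → ∏ i, g i T ≤ c' ^ (n - 1) := by
    intro T hT hbadT
    have h := h₂ n c hc hc1 (fun i T₂ => G i (T ∪ T₂))
      (fun i S S' hSS' hS'b => hanti i _ _ (Finset.union_subset_union subset_rfl hSS') (Finset.union_subset_union hT hS'b))
      (fun i S hS => hle1 i _ (Finset.union_subset_union hT hS))
      (fun i S hS => hge i _ (Finset.union_subset_union hT hS))
      (fun i S hS hgoodS => hgood i _ (Finset.union_subset_union hT hS) (Or.inr ((hpt₂ T S hT hS).2 hgoodS)))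
      (fun S hS hbadS => hbad _ (Finset.union_subset_union hT hS) (by
        rintro (h | h)
        · exact hbadT ((hpt₁ T S hT hS).1 h)
        · exact hbadS ((hpt₂ T S hT hS).1 h)))
    rw [hc']
    exact h
  have key := h₁ n c' hc'pos hc'1 g g_anti g_le g_ge g_good g_bad
  -- the union
  have hunion : (prodBernoulli p).real (A₁ ∪ A₂) =
      (prodBernoulli p).real A₁ + (1 - (prodBernoulli p).real A₁) * (prodBernoulli p).real A₂ := by
    have h := measureReal_union_add_inter (μ := prodBernoulli p) (s := A₁) (MeasurableSet.of_discrete : MeasurableSet A₂)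
    rw [prodBernoulli_real_inter_of_determinedBy_disjoint p hab hd₁ hd₂ MeasurableSet.of_discrete
      MeasurableSet.of_discrete] at h
    linear_combination h
  have htarget : (prodBernoulli p).real (A₁ ∪ A₂) + (1 - (prodBernoulli p).real (A₁ ∪ A₂)) * c =
      (prodBernoulli p).real A₁ + (1 - (prodBernoulli p).real A₁) * c' := by
    rw [hunion, hc']; ring
  rw [htarget, Finset.prod_congr rfl fun i _ => BEx_union p hab (G i)]
  exact key

/-! ## Graded safety implies safety -/

/-- `BEx` of a nonnegative function is nonnegative. [this work] -/
theorem BEx_nonneg (a : Finset ι) {F : Finset ι → ℝ} (h : ∀ T, T ⊆ a → 0 ≤ F T) : 0 ≤ BEx p a F :=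
  le_of_eq_of_le (BEx_const p a 0).symm (BEx_mono p a h)

/-- **Graded safety implies safety** (for an up-set determined by the block). [this work] -/
theorem safe_of_gsafe [Fintype ι] (a : Finset ι) {A : Set (Set ι)} (hd : DeterminedBy A (↑a : Set ι)) (hu : IsUpperSet A)
    (hA : GSafe p a A) : Safe p A := by
  classical
  intro n V hV hcap
  -- replace `V i` by `capIn a (V i ∪ A)`, determined by the block
  let W : Fin n → Set (Set ι) := fun i => capIn a (V i ∪ A)
  have hW : ∀ i, IsUpperSet (W i) := fun i => isUpperSet_capIn a ((hV i).union hu)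
  have hWd : ∀ i, DeterminedBy (W i) (↑a : Set ι) := fun i => determinedBy_capIn a _
  have hAW : ∀ i, A ⊆ W i := fun i =>
    (capIn_eq_of_determinedBy a hd).symm.subset.trans (capIn_mono a Set.subset_union_right)
  have hVW : ∀ i, V i ⊆ W i := fun i ω hω => (subset_capIn_inter_capOut a ((hV i).union hu) (Or.inl hω)).1
  have hWcap : ∀ i j, i ≠ j → W i ∩ W j ⊆ A := by
    intro i j hij
    change capIn a (V i ∪ A) ∩ capIn a (V j ∪ A) ⊆ A
    rw [← capIn_inter, ← capIn_eq_of_determinedBy a hd]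
    refine capIn_mono a ?_
    rw [capIn_eq_of_determinedBy a hd]
    rintro ω ⟨hi | hi, hj | hj⟩
    · exact hcap i j hij ⟨hi, hj⟩
    · exact hj
    · exact hi
    · exact hi
  -- the two-valued functions
  let v : Fin n → ℝ := fun i => (prodBernoulli p).real (W i)
  have key : ∀ c : ℝ, 0 < c → c ≤ 1 →
      ∏ i, (c + (1 - c) * v i) ≤ ((prodBernoulli p).real A + (1 - (prodBernoulli p).real A) * c) ^ (n - 1) := by
    intro c hc hc1
    let G : Fin n → Finset ι → ℝ := fun i T => c + (1 - c) * (if ((a \ T : Finset ι) : Set ι) ∈ W i then (1 : ℝ) else 0)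
    have hGeq : ∀ i, BEx p a (G i) = c + (1 - c) * v i := by
      intro i
      change BEx p a (fun T => c + (1 - c) * (if ((a \ T : Finset ι) : Set ι) ∈ W i then (1 : ℝ) else 0)) = _
      rw [BEx_affine, BEx_indicator_eq_real p (hWd i)]
    rw [← Finset.prod_congr rfl fun i _ => hGeq i]
    refine hA n c hc hc1 G ?_ ?_ ?_ ?_ ?_
    · intro i T T' hTT' _
      change c + (1 - c) * _ ≤ c + (1 - c) * _
      refine add_le_add_right (mul_le_mul_of_nonneg_left ?_ (sub_nonneg.2 hc1)) _
      split_ifs with h1 h2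
      · exact le_rfl
      · exact absurd (hW i (Finset.coe_subset.2 (Finset.sdiff_subset_sdiff subset_rfl hTT')) h1) h2
      · exact zero_le_one
      · exact le_rfl
    · intro i T _
      change c + (1 - c) * _ ≤ 1
      split_ifs <;> nlinarith
    · intro i T _
      change c ≤ c + (1 - c) * _
      split_ifs <;> nlinarith
    · intro i T _ hT
      change c + (1 - c) * _ = 1
      rw [if_pos (hAW i hT)]; ring
    · intro T _ hT
      -- at most one `W i` contains the bad point
      have hone : ∀ i j, i ≠ j → ((a \ T : Finset ι) : Set ι) ∈ W i → ((a \ T : Finset ι) : Set ι) ∉ W j :=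
        fun i j hij hi hj => hT (hWcap i j hij ⟨hi, hj⟩)
      by_cases hex : ∃ i, ((a \ T : Finset ι) : Set ι) ∈ W i
      · obtain ⟨i₀, hi₀⟩ := hex
        have hsplit := Finset.mul_prod_erase (Finset.univ : Finset (Fin n)) (fun i => G i T) (Finset.mem_univ i₀)
        rw [← hsplit]
        have h1 : G i₀ T = 1 := by change c + (1 - c) * _ = 1; rw [if_pos hi₀]; ring
        have h2 : ∀ i ∈ Finset.univ.erase i₀, G i T = c := by
          intro i hi
          change c + (1 - c) * _ = c
          rw [if_neg (hone i₀ i (Finset.ne_of_mem_erase hi).symm hi₀)]; ring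
        rw [h1, one_mul, Finset.prod_congr rfl h2, Finset.prod_const, Finset.card_erase_of_mem (Finset.mem_univ _),
          Finset.card_univ, Fintype.card_fin]
      · have hex' : ∀ i, ((a \ T : Finset ι) : Set ι) ∉ W i := fun i h => hex ⟨i, h⟩
        have h2 : ∀ i ∈ (Finset.univ : Finset (Fin n)), G i T = c := by
          intro i _; change c + (1 - c) * _ = c; rw [if_neg (hex' i)]; ring
        rw [Finset.prod_congr rfl h2, Finset.prod_const, Finset.card_univ, Fintype.card_fin]
        rcases n with _ | n
        · simp
        · rw [Nat.add_sub_cancel]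
          exact pow_le_pow_of_le_one hc.le hc1 (Nat.le_succ n)
  -- let the floor tend to zero
  let F : ℝ → ℝ := fun c => ∏ i, (c + (1 - c) * v i)
  let R : ℝ → ℝ := fun c => ((prodBernoulli p).real A + (1 - (prodBernoulli p).real A) * c) ^ (n - 1)
  have hF : Tendsto F (𝓝[>] 0) (𝓝 (F 0)) :=
    ((continuous_finsetProd _ fun i _ => by fun_prop : Continuous F).tendsto 0).mono_left nhdsWithin_le_nhds
  have hR : Tendsto R (𝓝[>] 0) (𝓝 (R 0)) := ((by fun_prop : Continuous R).tendsto 0).mono_left nhdsWithin_le_nhds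
  have hev : ∀ᶠ c in 𝓝[>] (0 : ℝ), F c ≤ R c := by
    have h1 : ∀ᶠ c in 𝓝[>] (0 : ℝ), c ∈ Set.Ioi (0 : ℝ) := self_mem_nhdsWithin
    have h2 : ∀ᶠ c in 𝓝[>] (0 : ℝ), c ∈ Set.Iio (1 : ℝ) := mem_nhdsWithin_of_mem_nhds (Iio_mem_nhds one_pos)
    filter_upwards [h1, h2] with c hc0 hc1'
    exact key c hc0 (le_of_lt hc1')
  have hlim : F 0 ≤ R 0 := le_of_tendsto_of_tendsto hF hR hev
  have hF0 : F 0 = ∏ i, v i := by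
    change ∏ i, ((0 : ℝ) + (1 - 0) * v i) = _
    exact Finset.prod_congr rfl fun i _ => by ring
  have hR0 : R 0 = ((prodBernoulli p).real A) ^ (n - 1) := by
    change ((prodBernoulli p).real A + (1 - (prodBernoulli p).real A) * 0) ^ (n - 1) = _
    rw [mul_zero, add_zero]
  rw [hF0, hR0] at hlim
  calc ∏ i, (prodBernoulli p).real (V i) ≤ ∏ i, v i :=
        Finset.prod_le_prod (fun i _ => measureReal_nonneg) fun i _ => measureReal_mono (hVW i)
    _ ≤ _ := hlim

end SafeCalc

end Summit.CriticalPhenomena.PercolationContinuityZ3.Theorems.SunflowerPartition
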